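import Summits.CriticalPhenomena.PercolationContinuityZ3.Theorems.PercNearOneGluingNoHeavyLowerTailBlockQ9DynCert
import HarnessLib

/-!
# `NoHeavyLowerTail` (stmt-CriticalPhenomena-4575, closed) — the dynamic-anchor certificate `BlockQ9.DynCert` is COMPLETE,
# for a trivial reason: `DynCert A b u O a ↔ (41)(u, O, a)`

Support note (hull-port seat `prim-hp-1` gen 18; helper for `stmt-CriticalPhenomena-4575`).  No definitions, no named facts, no sorries.

`BlockQ9.DynCert` (…BlockQ9DynCert.lean) is the inductive proof object of the dynamic-anchor exploration certificates
(EC-dyn / EC* of prim-lf-1's memo EC-NOTE.md §13) for Kozma–Nitzan's block inequality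
`(41)(u, O, a) :≡ μ_{glue_O u}(a ↔ b, O ↔ A) ≤ μ_{glue_O u}(O ↔ b)`; `DynCert.sound` is its soundness.
This file records the converse: whenever `O` is non-empty and `b ∈ A`, (41) itself yields a two-node certificate —
`switch` to any block vertex `o₀ ∈ O` (the transfer hypothesis of `switch o₀` IS (41), because under the glued weights the block
is almost surely one open cluster, so `O ↔ b` and `o₀ ↔ b` agree a.s., and `o₀ ↔ b ⊆ O ↔ A` as `b ∈ A`), then the leaf `l3 o₀`
with `le_rfl`.  Consequently `DynCert A b u O a ↔ (41)(u, O, a)` (`dynCert_iff_holds41`): the predicate carries NO completeness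
content about any search procedure, and the last disjunct `DynCert A b u (insert v O) a` of the hypothesis schema
`BlockQ9.LocalStep` (…BlockQ9DynReduction.lean) is an oracle for "(41) survives growing the block by `v` with the same anchor".
(Context: ttrl hp1pp/ECSTAR.md (E1) refutes EC-dyn as a complete SEARCH procedure; that statement is about the move set of the
search, not about `DynCert`; memo prim-hp-1/E1-LEAN-SCHEMA-CHECK.md.)
[cite: KozmaNitzan2024, Question 9 (p. 36)]
-/

namespace Summit.CriticalPhenomena.PercolationContinuityZ3.Theorems

open MeasureTheory Set
open Literature.Probability.LatticeModels
open Literature.Probability.Percolation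

noncomputable section
open Classical

namespace BlockQ9

variable {n : ℕ}

/-- Under the glued weights of a block `O ∋ o₀`, with `b ∈ A`: `μ(O ↔ b) ≤ μ(o₀ ↔ b, O ↔ A)` (in fact equality) — almost surely
the block is one open cluster (`glue_conull`), so `O ↔ b` is `o₀ ↔ b`, which is one of the events in `O ↔ A`. [folklore] -/
theorem glue_real_blockConn_le_inter (u : Sym2 (Fin n) → unitInterval) (O A : Finset (Fin n)) (b o₀ : Fin n)
    (ho₀ : o₀ ∈ O) (hbA : b ∈ A) :
    (prodBernoulli (fun d : Sym2 (Fin n) => if (∀ x ∈ d, x ∈ O) ∧ ¬ d.IsDiag then 1 else u d)).real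
        (⋃ o ∈ O, openConn o b) ≤
      (prodBernoulli (fun d : Sym2 (Fin n) => if (∀ x ∈ d, x ∈ O) ∧ ¬ d.IsDiag then 1 else u d)).real
        (openConn o₀ b ∩ ⋃ o ∈ O, ⋃ x ∈ A, openConn o x) := by
  set g : Sym2 (Fin n) → unitInterval := fun d => if (∀ x ∈ d, x ∈ O) ∧ ¬ d.IsDiag then 1 else u d with hg
  set K : Set (BondConfig (Fin n)) := {ω | ∀ o ∈ O, ∀ o' ∈ O, o ≠ o' → s(o, o') ∈ ω} with hK
  have hKc : prodBernoulli g Kᶜ = 0 := glue_conull u O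
  -- on the conull event `K` the two events coincide
  have hiff : ∀ ω, ω ∈ (univ : Set (BondConfig (Fin n))) → ω ∈ K →
      (ω ∈ (⋃ o ∈ O, openConn o b : Set (BondConfig (Fin n))) ↔
        ω ∈ (openConn o₀ b ∩ ⋃ o ∈ O, ⋃ x ∈ A, openConn o x : Set (BondConfig (Fin n)))) := by
    intro ω _ hωK
    simp only [mem_inter_iff, mem_iUnion]
    constructor
    · rintro ⟨o, ho, hob⟩
      have h₀ : (openGraph ω).Reachable o₀ b := (reachable_of_mem_block hωK ho₀ ho).trans hob
      exact ⟨h₀, o₀, ho₀, b, hbA, h₀⟩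
    · rintro ⟨hob, -⟩
      exact ⟨o₀, ho₀, hob⟩
  have e := sigmaRec_inter_congr g (L := univ) hKc hiff
  simp only [univ_inter] at e
  exact le_of_eq e

/-- **Completeness of `DynCert` (trivial form).**  If the block `O` is non-empty, `b ∈ A`, and (41) holds for `(u, O, a)`, then
`DynCert A b u O a`: `switch` to a block vertex `o₀` (its transfer hypothesis is (41) by `glue_real_blockConn_le_inter`), then the
leaf `l3 o₀` with `le_rfl`. [this work; cite: KozmaNitzan2024, Question 9 (p. 36)] -/
theorem DynCert.complete {A : Finset (Fin n)} {b : Fin n} {u : Sym2 (Fin n) → unitInterval} {O : Finset (Fin n)} {a : Fin n}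
    (o₀ : Fin n) (ho₀ : o₀ ∈ O) (hbA : b ∈ A)
    (h41 : (prodBernoulli (fun d : Sym2 (Fin n) => if (∀ x ∈ d, x ∈ O) ∧ ¬ d.IsDiag then 1 else u d)).real
        (openConn a b ∩ ⋃ o ∈ O, ⋃ x ∈ A, openConn o x) ≤
      (prodBernoulli (fun d : Sym2 (Fin n) => if (∀ x ∈ d, x ∈ O) ∧ ¬ d.IsDiag then 1 else u d)).real
        (⋃ o ∈ O, openConn o b)) :
    DynCert A b u O a :=
  DynCert.switch o₀ (h41.trans (glue_real_blockConn_le_inter u O A b o₀ ho₀ hbA)) (DynCert.l3 o₀ ho₀ le_rfl)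

/-- **`DynCert` is exactly (41).**  For a non-empty block `O ∋ o₀` and `b ∈ A`:
`DynCert A b u O a ↔ μ_{glue_O u}(a ↔ b, O ↔ A) ≤ μ_{glue_O u}(O ↔ b)`.  So a `DynCert` term certifies nothing beyond (41) itself,
and completeness questions for exploration certificates (EC-dyn, EC*, …) concern the move set of the SEARCH, not this predicate.
[this work; cite: KozmaNitzan2024, Question 9 (p. 36)] -/
theorem dynCert_iff_holds41 {A : Finset (Fin n)} {b : Fin n} {u : Sym2 (Fin n) → unitInterval} {O : Finset (Fin n)} {a : Fin n}
    (o₀ : Fin n) (ho₀ : o₀ ∈ O) (hbA : b ∈ A) :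
    DynCert A b u O a ↔
      (prodBernoulli (fun d : Sym2 (Fin n) => if (∀ x ∈ d, x ∈ O) ∧ ¬ d.IsDiag then 1 else u d)).real
          (openConn a b ∩ ⋃ o ∈ O, ⋃ x ∈ A, openConn o x) ≤
        (prodBernoulli (fun d : Sym2 (Fin n) => if (∀ x ∈ d, x ∈ O) ∧ ¬ d.IsDiag then 1 else u d)).real
          (⋃ o ∈ O, openConn o b) :=
  ⟨DynCert.sound, DynCert.complete o₀ ho₀ hbA⟩

end BlockQ9

end

end Summit.CriticalPhenomena.PercolationContinuityZ3.Theorems
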